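import Mathlib
import HarnessLib
import Summits.CriticalPhenomena.Statement
import Literature.Probability.Percolation.InterfaceScalingLimit
import Literature.Probability.RandomPlanarGeometry.SLEConvergenceCriterion
import Literature.Probability.LatticeModels.FermionicObservable

/-!
Route: CardyWindingIG

# Route CardyWindingIG — SLE6 on Z2 by coupling rigidity — the exploration tree's winding field as
an imaginary-geometry GFF (Schramm–Sheffield in reverse at kappa'=6)

It suffices to show X_IG = WindingFieldGFF ∧ IGCouplingRigidity (card
winding-field-imaginary-geometry, run as
Schramm–Sheffield arXiv:math/0605337 IN REVERSE at κ′ = 6): root the bond-ℤ² percolation exploration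
tree of a
Dobrushin domain at a_δ and let W_δ(z) be the intrinsic winding (sum of ±π/2 turns on medial ℤ²) of
the branch
targeting z; (WindingFieldGFF) (1/√6)(W_δ − 𝔼W_δ) converges, jointly with the chordal interface η_δ,
to a Dirichlet
GFF plus the harmonic extension of imaginary-geometry boundary data, uniformly over slit
sub-domains;
(IGCouplingRigidity) every subsequential joint limit (h, η) then satisfies the Miller–Sheffield
coupling axioms, so
by MS IG I Thm 2.4/1.1 (named facts) η is chordal SLE_{κ′} with κ′ forced to be 6. Typed shadow of
X_IG filed now:
the target IdentifiedLimitsSLE6 (every subsequential limit law of `bondInterface` is `IsSLELaw 6`),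
which with
Aizenman–Burchard tightness and the PROVED criterion `convergesInLawToSLE_of_isTightLaws` gives
`SLE6LimitZ2`, and
then CardyFormulaZ2 through the shared item `SLE6LimitZ2 → CardyFormulaZ2` (stmt-0697 / CardyViaSLE6
tail).
Lean: `∀ D : Literature.Probability.RandomPlanarGeometry.DobrushinDomain, (∀ᶠ δ in nhdsWithin (0:ℝ)
(Set.Ioi 0), (Literature.Probability.Percolation.dobrushinData D δ).IsZdAdmissible) → ∀ μ :
MeasureTheory.Measure (Literature.Probability.RandomPlanarGeometry.CurveClass ℂ),
MeasureTheory.IsProbabilityMeasure μ → Literature.Probability.RandomPlanarGeometry.IsSubseqLimitLaw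
(Ωδ := fun _ => Literature.Probability.Percolation.BondConfig
(Literature.Probability.LatticeModels.Site 2)) (Literature.Probability.Percolation.bondInterface D)
(fun _ => Literature.Probability.Percolation.bondPercolation
(Literature.Probability.LatticeModels.zdGraph 2) Literature.Probability.Percolation.half) μ →
Literature.Probability.RandomPlanarGeometry.IsSLELaw 6 D μ`

## Assembly
Pure logic (sorry-free in Sketch.lean): given IdentifiedLimitsSLE6, LimitUpgrade turns it into
SLE6LimitZ2 using the three
Literature facts as hypotheses, and SLE6ToCardy (shared with CardyRotToConf/CardyViaSLE6) gives
CardyFormulaZ2. The informal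
cruxes r2 (WindingFieldGFF), r3 (IGCouplingRigidity), r5 (BranchWindingNormalisation), filed right
after open because the GFF /
exploration-tree notions are not in Lean yet, are what proves the target; HullWindingLawZ2/Tri are
the typed necessary
conditions and calibration of r2 that refuters can test today.

Rationale: WHY THIS LINE. Identification by COUPLING RIGIDITY with a Gaussian field, not by symmetry upgrade
(CardyViaSLE6 r2, CardyRotToConf r2) and
not by an exact observable (CardyDiscreteHolo, CardyHarmonicInvariants): Berestycki–Laslier–Ray
(arXiv:1603.09740, Thm 1.2: UST
winding field → (1/χ)·GFF, χ = 1/√2) ran the dictionary "tree-branch winding = imaginary-geometry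
GFF" FORWARDS at κ = 2 from
known SLE₂; Schramm–Sheffield (arXiv:math/0605337 §1.2, Thm t.gap + SLE(4) theorem) ran "Gaussian
lattice field ⇒ curve law"
with an exactly Gaussian field; here the two are combined BACKWARDS on bond-ℤ² percolation, whose
exploration tree is an honest
function of the configuration. New structural reason it can only work here (planner's computation,
sources below): the winding
of a tree branch at its target has variance κ′·log(1/δ) (Schramm, arXiv:math/9904022 §7 Thm "winding
number of SLE", §8: LERW
constant 2), while a field whose (counter)flow lines the branches are must have variance (1/χ²)·log
= 4κ′/(κ′−4)²·log
(Miller–Sheffield; KMSW arXiv:1605.06471 p.3); these agree iff (κ′−4)² = 4, i.e. exactly for UST (κ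
= 2, BLR) and
PERCOLATION (κ′ = 6) — so the κ′-selector is the measurable normalisation c_W = 6, and the two-sided
gap 2λ′/χ = 2π is
then FORCED by Gaussianity + the exact lattice Markov property through the martingale bookkeeping of
MS IG I Thm 2.4
(arXiv:1201.1496 §2.3), exactly as λ = √(π/8) is derived, not posited, in SS09. Imported areas:
imaginary geometry /
GFF local sets (MS 1201.1496, Dubédat 0712.3018, Aru–Sepúlveda–Werner 1603.03362), GFF convergence
technology at the
percolation point of ℤ² (DKLM arXiv:2603.06268 Thm 2.8: six-vertex height → σ·GFF for Δ ∈ [−1,−1/2],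
c = √3 being
q = 1), Coulomb-gas winding laws (Duplantier–Saleur 1988, Duplantier–Binder cond-mat/0208045). All
conformal
invariance enters through the limiting Gaussian field; nothing is asked of the curves but tightness
(AB99, a fact).

RANKED CRUXES. #0 IdentifiedLimitsSLE6 (target) — for every Dobrushin domain with eventually
ℤ²-admissible canonical discretisations, every subsequential weak limit law μ (a probability measure
on CurveClass ℂ) of the laws of the medial exploration interface `bondInterface D δ` under P_{1/2},
δ → 0⁺, is the chordal SLE₆ law in D (`IsSLELaw 6 D μ`). This is the OUTPUT of the coupling-rigidity
step (informal cruxes r2, r3 filed after open) and, with tightness, is equivalent to SLE6LimitZ2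
(support LimitUpgrade). (why it might fail: it is Smirnov's conjecture minus tightness: a
subsequential limit that is not conformally invariant (only similarity-invariant, DKKMO) refutes it
and the conjunct; vacuous on domains whose canonical data are never admissible (disc, axis
rectangles).) [Smirnov2001, arXiv:math/9904022, CamiaNewman2007,
lean:Literature.Probability.RandomPlanarGeometry.convergesInLawToSLE_of_isTightLaws]
#4 HullWindingLawZ2 (crux) — TYPICAL-POINT WINDING LAW ON ℤ² (card R2, substep "two-point function
with the right constant", restricted to the interface; Duplantier–Saleur/Duplantier–Binder law for
percolation hulls on ℤ², never proved): for a Dobrushin domain with eventually admissible data, r >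
0 and t ∈ ℝ, let W_k be the intrinsic winding (sum of turning angles, `LatticeModels.winding`) of
the first k steps of the medial exploration path; averaging e^{i t W_k/√(log δ⁻¹)} over the steps k
at distance ≥ r from ∂Ω (size-biased typical interior point), the P_{1/2}-expectation tends to
e^{−(3/4)t²}: W_k/√(log 1/δ) is asymptotically centred Gaussian with variance 3/2 = κ′/4 (two-strand
rotation coefficient at κ′ = 6). [difficulty: open-problem] (why it might fail: the coefficient 3/2
is the 2-strand prediction κ′/4 (Duplantier–Binder 1/k² rule), unproved even for SLE₆;
step-count-typical ≠ natural-measure-typical or a non-zero mean drift E W_k ≫ 1 would break it as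
typed; Wieland–Wilson numerics only.) [doi:10.1103/PhysRevE.68.056101, arXiv:cond-mat/0208045,
arXiv:math/9904022, arXiv:1605.06471, doi:10.1103/PhysRevLett.60.2343]
#6 HullWindingLawTri (crux) — CALIBRATION ON 𝕋 (refuter's missing calibration, novelty audit point
(3)): the same typical-point winding law, e^{−(3/4)t²}, for the hexagonal exploration path of
critical site percolation on δ𝕋 (turns ±π/3; `explorationWalk`, `hexCenter`), where convergence to
SLE₆ is a theorem (fact `convergesInLawToSLE_six_triInterface`, Smirnov/Camia–Newman); provable in
principle from that fact + RSW scale decorrelation + the SLE₆ two-strand rotation law, and it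
certifies that the statistic used on ℤ² measures κ′/4. [difficulty: L] (why it might fail: SLE₆
convergence mod reparametrisation does not see lattice-scale turning; the log(1/δ) coefficient needs
uniform-in-scale decorrelation and the SLE₆ 2-strand rotation law (Duplantier–Binder), neither a
theorem; canonical-data guard may be vacuous on symmetric domains.) [CamiaNewman2007, Smirnov2001,
arXiv:cond-mat/0208045, arXiv:math/9904022,
lean:Literature.Probability.Percolation.convergesInLawToSLE_six_triInterface]
#9 NonSimpleLimitsZ2 (support) — flow/counterflow disambiguation: every subsequential limit law of
the ℤ² interface gives mass 0 to the classes of SIMPLE curves (the limit touches itself), so in the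
IG dictionary the curve is a counterflow line (κ′ = 6) and not a flow line (κ = 8/3, simple), the
two roots of χ² = 1/6. Expected provable from the ℤ² polychromatic 4-arm bound α₄ < 2 (pivotals at
all scales; Literature ArmExponentsFourArm / Kesten scaling relations) + RSW. [difficulty: L]
[Kesten1987ScalingRelations, AizenmanBurchard1999, arXiv:math/9904022]
#9 LimitUpgrade (support) — identification of subsequential limits + Aizenman–Burchard tightness
(fact `isTightLaws_map_bondInterface`) + a.e.-measurability (fact `aemeasurable_bondInterface`) +
uniqueness of the chordal SLE₆ law (fact `IsSLECurve.map_eq`) ⇒ SLE6LimitZ2; a three-line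
consequence of the PROVED criterion `convergesInLawToSLE_of_isTightLaws` (checked sorry-free in the
planner sketch, axioms standard). [difficulty: provable-now] [BillingsleyCPM1999,
AizenmanBurchard1999,
lean:Literature.Probability.RandomPlanarGeometry.convergesInLawToSLE_of_isTightLaws]
#9 SLE6ToCardy (support) — SLE₆ convergence of the ℤ² interface ⇒ Cardy's formula (portmanteau on
the hitting event + LSW's SLE₆ hitting law); this is literally the assembly item
stmt-CriticalPhenomena-0697 of route CardyRotToConf and is decomposed in route CardyViaSLE6
(InterfaceDictionary stmt-0754, HitsBeforeNullFrontier stmt-0755, AdmissibleSuffices stmt-0756, fact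
sle_six_measureReal_hitsBefore); re-filed here verbatim so the routes share it. [difficulty: L]
[CamiaNewman2007, LawlerSchrammWerner2001, Smirnov2001]

TWO-LAYER PLAN. Foreseen glued splits once a crux closes (k ≤ 3, depth 1): WindingFieldGFF ⇐
(two-point function = 6·G_Ω, i.e. r5) →
(vanishing of higher cumulants of seam observables, DKLM-type transfer-matrix/rotation-invariance
argument) → (identification
of IG boundary data: SS-type gap theorem "E[W near η | η] = winding ± π") → WindingFieldGFF;
IGCouplingRigidity ⇐ (uniform
field convergence in slit domains / local-set regularity à la SS09 §3–4) → (martingale bookkeeping: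
MS IG I Thm 2.4 applied to
the limit, with NonSimpleLimitsZ2 choosing the counterflow root) → IGCouplingRigidity;
HullWindingLawTri ⇐ (scale
decorrelation of turning from RSW) → (2-strand rotation law of SLE₆) → HullWindingLawTri.

KILL CRITERIA. Refutation of HullWindingLawZ2 with a DIFFERENT positive coefficient kills only the
typical-point statistic (re-specify); with
a non-Gaussian limit or an embedding-dependent coefficient it kills WindingFieldGFF and the route
(close refuted). A Monte-Carlo
or theorem showing the branch-endpoint normalisation c_W ≠ 6 on 𝕋 (where SLE₆ is known) kills the
dictionary (r5) and the
route outright. ¬IdentifiedLimitsSLE6 (a non-conformally-invariant subsequential limit) refutes the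
conjunct itself. If
CardyViaSLE6/CardyRotToConf prove SLE6LimitZ2 first, this route is mooted (superseded) but r2 keeps
independent value (DCS
parafermion conjecture at q = 1, CLE₆ on ℤ² via the tree).

NOT DECOMPOSED YET. The GFF side (cumulant bounds for multi-charge seam observables, the DKLM
transfer to the winding field, boundary/IG data in
rough domains), the precise pocket re-rooting convention of the lattice exploration tree (part of
definition request D1), the
local-set/absolute-continuity technology for r3, rates, and the radial/full-plane CLE₆ by-product —
all layer-2 children after
r5 or r4 closes. No third layer will be filed; lemmas ride with `--supports`.

CHEAPEST FALSIFIER. (a) Arithmetic already run by the planner: self-consistency κ′ = 4κ′/(κ′−4)²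
holds at κ′ = 6 (and only there among κ′ > 4) —
passed. (b) One evening of Monte-Carlo on bond-ℤ² at p = 1/2 (kit job for a refuter): variance of
the intrinsic winding of the
exploration branch at a fixed interior target vs log(1/δ) must have slope 6 (r5) and at typical
interface points slope 3/2
(r4), with vanishing 4th cumulant; Wieland–Wilson (PRE 68, 056101) report the typical-point
measurement for FK q = 1…4 on ℤ².
(c) Lookup: does BLR's machinery (1603.09740 §3, continuum winding of truncated SLE branches)
already give r5/r2 on 𝕋 from
Camia–Newman? If yes, HullWindingLawTri and the 𝕋-half of r5 are `known` and the dictionary is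
certified at κ′ = 6.

NUMBERS. χ(κ) = 2/√κ − √κ/2, λ = π/√κ, λ′ = π/√κ′ (MS IG I Thm 1.1, arXiv:1201.1496 p.7–8); 1/χ² =
4κ′/(κ′−4)² (KMSW arXiv:1605.06471
p.3, eq. g-chi-kappa) = 6 at κ′ = 6, = 2 at κ′ = 8; radial SLE_κ winding variance κ·log(1/ε)
(Schramm arXiv:math/9904022 §7,
Thm "t.wind"; LERW: 2 log(1/ε), §8 eq. e.wnv); k-strand rotation variance reduced by 1/k²
(Duplantier–Binder
arXiv:cond-mat/0208045 p.4), so typical-point coefficient κ′/4 = 3/2 and Peano check 8/4 = 2 =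
1/χ²(8) (KMSW p.4);
counterflow gap in W-units 2λ′/|χ| = 4π/(κ′−4) = 2π at 6 (π at 8); flow gap 4π/(4−κ) = 3π at 8/3; SS
height gap λ = √(π/8)
(math/0605337 §1.2); DKLM σ² = 2/arccos(−Δ)… = 3/π at Δ = −1/2 (arXiv:2603.06268 Thm 2.8); BLR: h −
𝔼h → (1/χ)h⁰_GFF,
χ = 1/√2 (1603.09740 Thm 1.2). Items at open: 7 typed (target, 2 cruxes, 3 support, assembly) + 3
informal cruxes to file.

DEFINITION REQUESTS. D1 (Literature/Probability/LatticeModels): `explorationBranch` / `windingField`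
— the percolation exploration TREE on medial
δℤ² in a discrete Dobrushin (or rooted Jordan) domain: radial exploration targeting a medial vertex
z = chordal medial
exploration with target switching at disconnection times and Sheffield's boundary-override
convention inside sealed pockets
(arXiv:math/0609167 §1–2; Camia–Newman 2007 §3 for the lattice loop process), and W_δ(z) :=
`winding` of that branch.
D2 (Literature/Probability/RandomPlanarGeometry): `DirichletGFF` on a Jordan/slit domain as a random
distribution (Gaussian,
covariance the Dirichlet Green function via a uniformizing map; DKLM Def. 2.6–2.7 modes of
convergence) and
`IsImaginaryGeometryCoupling κ′ D (h, η)` — the MS IG I Thm 1.1 conditional-law axioms for a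
counterflow line.
Cite facts wanted (family crit-ising / crit-perc): MS IG I Thm 1.1, Thm 1.2, Thm 2.4
(arXiv:1201.1496); Schramm2000 §7
winding theorem; BLR Thm 1.2 (arXiv:1603.09740); DKLM Thm 2.8 (arXiv:2603.06268); Sheffield
exploration-tree ⇒ CLE_κ′
(arXiv:math/0609167 Thm 1.?); Camia–Newman full scaling limit (CamiaNewman2006).

Novelty: Searches (2026-08-15): `lean search` for GFF/imaginary geometry/level line/Miller–Sheffield in
Mathlib+Literature (0 decls: no
GFF, no IG; found LatticeModels.ExplorationWinding, FermionicObservable.winding,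
RandomPlanarGeometry.SLEConvergenceCriterion);
`lit search "winding angle variance Fortuin-Kasteleyn contours"` (local searchd down, conn reset
×3), `--source arxiv` (HTTP
429), `--source openalex` ×3 (budget exhausted), `lit galaxy search "winding angle variance" --star
all` (0 rows, pdf/crabby
queued-out); `lit papers --grep` Wieland|Imaginary geometry|Contour lines|exploration
tree|six-vertex|winding (1 held: BLR);
materialised and READ: arXiv:1605.06471 pp.3–4, arXiv:cond-mat/0208045 p.4, arXiv:math/9904022
§§7–8, arXiv:1201.1496 pp.4,
7–8, 14 (Thms 1.1, 1.2, 2.4), arXiv:2603.06268 p.11 (Thm 2.8), BLR galaxy-pdf-3393931370180049180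
p.3 (Thm 1.2),
arXiv:math/0605337 pp.3–4 (§1.2 height gap); all 6 CardyFormulaZ2 route files and the 125-card idea
list (no route or card
uses coupling rigidity; refuter audit of the card found KMSW + BLR as nearest prior art).
Nearest prior art found: arXiv:1605.06471 (KMSW: 6V height = Peano winding, g = χ² heuristic + Monte
Carlo, other model,
forward/heuristic), arXiv:1603.09740 (BLR Thm 1.2, κ = 2 forward), arXiv:math/0605337 (SS: exactly
Gaussian field ⇒ SLE₄),
arXiv:1201.1496 (MS rigidity theorems), arXiv:2603.06268 (GFF at the percolation point of ℤ² for the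
BKW height).
Delta: SS-in-reverse + MS Thm 2.4 aimed at bond-ℤ² percolation  [refs: 1605.06471, cond-mat/0208045, math/9904022, 1201.1496, 2603.06268, math/0605337, 1603.09740]

Barriers (technique_class: imaginary-geometry, coupling-rigidity, winding-field-gff): - technique_class: imaginary-geometry, coupling-rigidity, winding-field-gff
- Literature.Barriers.CriticalPhenomena.EmbeddingModulusUniqueness: evaded by an embedding-specific
input — W is the EUCLIDEAN turning of the square embedding and r2's proof must use isotropic weights
+ DKKMO rotation invariance (DKLM's Ingredient); on a sheared copy diag(1,p)ℤ² the winding field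
cannot converge to an isotropic GFF, so the argument is not shared by the two embeddings (Beffara's
dichotomy respected).
- Literature.Barriers.CriticalPhenomena.FKParafermionicHalfCauchyRiemann: the q = 1 parafermion is
one Fourier mode E[e^{iσW}1_{e∈γ}] of W on the interface; this line never poses the half-CR boundary
value problem — it asks for the LAW of W (all charges, off the curve) by transfer-matrix/GFF
technology and identifies curves by MS Thm 2.4; honest cost: r2 is at least as strong as the DCS
parafermion conjecture at q = 1, so the barrier is bypassed in aim, not beaten in strength.
- Literature.Barriers.CriticalPhenomena.SmirnovTriangularOnly: no colour switching, no harmonic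
triple, no ψ(e); the 𝕋 appearance (HullWindingLawTri, r5-calibration) uses Camia–Newman's theorem as
an INPUT, not Smirnov's mechanism as a transplant.
- Literature.Barriers.CriticalPhenomena.CoveringLatticeShift: no model interpolation or shift
pairing is used.
- Literature.Barriers.CriticalPhenomena.ScaleCovarianceNotMoebius: its moral (symmetry data alone do
not identify a limit) is WHY identification here is by a coupl

Novelty grade: new-combination — ROUTE REVIEW (refuter, 2026-08-15). NOVELTY new-combination: SS09 'Gaussian field ⇒ curve law' in reverse + MS IG I Thm 2.4, aimed at the bond-Z² exploration tree. The CONTINUUM dictionary is known (MS IG I/IV + Sheffield: CLE_κ' exploration tree = GFF branching counterflow lines; at κ'=6 the branch (refuter refuter-rreview-route-CriticalPhenomena--7dc828c2-0, 2026-08-15T14:00:57Z; prior: arXiv:math/0605337 (SS09, run in reverse), arXiv:1201.1496 (MS IG I Thm 1.1/1.2/2.4), arXiv:1302.4738 (MS IG IV: branching counterflow lines = continuum exploration tree), arXiv:1603.09740 (BLR Thm 1.2, κ=2 forward), arXiv:1605.06471 (KMSW p.3, g=χ²), arXiv:2603.06268 (DKLM Thm 2.8), arXiv:1002.3220 (Wieland–Wilson,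 κ/4 typical-point numerics), arXiv:math/0609167 (Sheffield exploration trees))

History (route lifecycle, newest last):
- 2026-08-15T11:55:52Z · rev 1: dropped stmt-CriticalPhenomena-6832, stmt-CriticalPhenomena-6833 — dedupe: the informal crux WindingFieldGFF was accidentally filed three times (CLI re-run to capture its id); keep stmt-CriticalPhenomena-6831, drop the two iden (planner-plancard-CriticalPhenomena-CardyFormu-b58884eb-0)

sub-problem: CardyFormulaZ2 · status: open · opened planner-plancard-CriticalPhenomena-CardyFormu-b58884eb-0 2026-08-15T11:42:10Z · rev 0 · ledger route-CriticalPhenomena-CardyWindingIG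
GENERATED by the gate from the ledger (D-0016/17). Provers cite these decls: `theorem foo : Summit.CriticalPhenomena.CardyFormulaZ2.Theses.CardyWindingIG.<Decl> := …` in Summits/CriticalPhenomena/CardyFormulaZ2/Theorems/<Name>.lean.
-/

namespace Summit.CriticalPhenomena.CardyFormulaZ2.Theses.CardyWindingIG

open scoped BigOperators Topology Manifold Classical MeasureTheory ProbabilityTheory Matrix InnerProductSpace ComplexConjugate ContinuousMap
open Filter Set Function TopologicalSpace MeasureTheory

/-- item stmt-CriticalPhenomena-5706 · target · rank 0 · open · by planner
why it might fail: it is Smirnov's conjecture minus tightness: a subsequential limit that is not conformally invariant (only similarity-invariant, DKKMO) refutes it and the conjunct; vacuous on domains whose canonical data are never admissible (disc, axis rectangles).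
sources: Smirnov2001, arXiv:math/9904022, CamiaNewman2007, lean:Literature.Probability.RandomPlanarGeometry.convergesInLawToSLE_of_isTightLaws
[target] for every Dobrushin domain with eventually ℤ²-admissible canonical discretisations, every
subsequential weak limit law μ (a probability measure on CurveClass ℂ) of the laws of the medial
exploration interface `bondInterface D δ` under P_{1/2}, δ → 0⁺, is the chordal SLE₆ law in D
(`IsSLELaw 6 D μ`). This is the OUTPUT of the coupling-rigidity step (informal cruxes r2, r3 filed
after open) and, with tightness, is equivalent to SLE6LimitZ2 (support LimitUpgrade). -/
def IdentifiedLimitsSLE6 : Prop :=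
  ∀ D : Literature.Probability.RandomPlanarGeometry.DobrushinDomain, (∀ᶠ δ in nhdsWithin (0:ℝ) (Set.Ioi 0), (Literature.Probability.Percolation.dobrushinData D δ).IsZdAdmissible) → ∀ μ : MeasureTheory.Measure (Literature.Probability.RandomPlanarGeometry.CurveClass ℂ), MeasureTheory.IsProbabilityMeasure μ → Literature.Probability.RandomPlanarGeometry.IsSubseqLimitLaw (Ωδ := fun _ => Literature.Probability.Percolation.BondConfig (Literature.Probability.LatticeModels.Site 2)) (Literature.Probability.Percolation.bondInterface D) (fun _ => Literature.Probability.Percolation.bondPercolation (Literature.Probability.LatticeModels.zdGraph 2) Literature.Probability.Percolation.half) μ → Literature.Probability.RandomPlanarGeometry.IsSLELaw 6 D μ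

-- item stmt-CriticalPhenomena-6831 · crux · rank 2 · open · by planner — informal only, no Lean statement yet:
--   [crux] WindingFieldGFF (card R2; hardest). Let (Ω; a, b) be a Dobrushin domain with eventually
--   ℤ²-admissible data and let W_δ(z), z a medial vertex of Ω_δ, be the intrinsic winding (sum of ±π/2
--   turns, LatticeModels.winding) of the branch of the bond-percolation exploration TREE rooted at a_δ
--   targeting z (definition request D1: chordal medial exploration with target switching at
--   disconnection times, Sheffield's boundary-override convention in sealed pockets). Then h_δ :=
--   (1/√6)(W_δ − 𝔼W_δ), viewed as a distribution on Ω, converges in law (finite-dimensional marginals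
--   against finite-Dirichlet-en

/-- item stmt-CriticalPhenomena-5707 · crux · rank 4 · open · by planner
why it might fail: the coefficient 3/2 is the 2-strand prediction κ′/4 (Duplantier–Binder 1/k² rule), unproved even for SLE₆; step-count-typical ≠ natural-measure-typical or a non-zero mean drift E W_k ≫ 1 would break it as typed; Wieland–Wilson numerics only.
sources: doi:10.1103/PhysRevE.68.056101, arXiv:cond-mat/0208045, arXiv:math/9904022, arXiv:1605.06471, doi:10.1103/PhysRevLett.60.2343
[crux] TYPICAL-POINT WINDING LAW ON ℤ² (card R2, substep "two-point function with the right
constant", restricted to the interface; Duplantier–Saleur/Duplantier–Binder law for percolation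
hulls on ℤ², never proved): for a Dobrushin domain with eventually admissible data, r > 0 and t ∈ ℝ,
let W_k be the intrinsic winding (sum of turning angles, `LatticeModels.winding`) of the first k
steps of the medial exploration path; averaging e^{i t W_k/√(log δ⁻¹)} over the steps k at distance
≥ r from ∂Ω (size-biased typical interior point), the P_{1/2}-expectation tends to e^{−(3/4)t²}:
W_k/√(log 1/δ) is asymptotically centred Gaussian with variance 3/2 = κ′/4 (two-strand rotation
coefficient at κ′ = 6). [difficulty: open-problem] -/
def HullWindingLawZ2 : Prop :=
  ∀ D : Literature.Probability.RandomPlanarGeometry.DobrushinDomain, (∀ᶠ δ in nhdsWithin (0:ℝ) (Set.Ioi 0), (Literature.Probability.Percolation.dobrushinData D δ).IsZdAdmissible) → ∀ r t : ℝ, 0 < r → Filter.Tendsto (fun δ : ℝ => (∫ ω, (fun pts : List ℂ => ∑ k ∈ Finset.range pts.length, if r ≤ Metric.infDist (pts.getD k 0) (frontier D.carrier) then Complex.exp (Complex.I * (t : ℂ) * ((Literature.Probability.LatticeModels.winding (pts.take (k + 1)) / Real.sqrt (Real.log δ⁻¹) : ℝ) : ℂ)) else 0) ((Literature.Probability.LatticeModels.medialExploration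 (Literature.Probability.Percolation.dobrushinData D δ) ω).map (Literature.Probability.LatticeModels.medialPoint δ)) ∂(Literature.Probability.Percolation.bondPercolation (Literature.Probability.LatticeModels.zdGraph 2) Literature.Probability.Percolation.half)) / (∫ ω, (fun pts : List ℂ => ∑ k ∈ Finset.range pts.length, if r ≤ Metric.infDist (pts.getD k 0) (frontier D.carrier) then (1 : ℂ) else 0) ((Literature.Probability.LatticeModels.medialExploration (Literature.Probability.Percolation.dobrushinData D δ) ω).map (Literature.Probability.LatticeModels.medialPoint δ)) ∂(Literature.Probability.Percolation.bondPercolation (Literature.Probability.LatticeModels.zdGraph 2) Literature.Probability.Percolation.half))) (nhdsWithin 0 (Set.Ioi 0)) (nhds (Complex.exp (-(3 / 4 * (t : ℂ) ^ 2))))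

/-- item stmt-CriticalPhenomena-5708 · crux · rank 6 · open · by planner
why it might fail: SLE₆ convergence mod reparametrisation does not see lattice-scale turning; the log(1/δ) coefficient needs uniform-in-scale decorrelation and the SLE₆ 2-strand rotation law (Duplantier–Binder), neither a theorem; canonical-data guard may be vacuous on symmetric domains.
sources: CamiaNewman2007, Smirnov2001, arXiv:cond-mat/0208045, arXiv:math/9904022, lean:Literature.Probability.Percolation.convergesInLawToSLE_six_triInterface
[crux] CALIBRATION ON 𝕋 (refuter's missing calibration, novelty audit point (3)): the same
typical-point winding law, e^{−(3/4)t²}, for the hexagonal exploration path of critical site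
percolation on δ𝕋 (turns ±π/3; `explorationWalk`, `hexCenter`), where convergence to SLE₆ is a
theorem (fact `convergesInLawToSLE_six_triInterface`, Smirnov/Camia–Newman); provable in principle
from that fact + RSW scale decorrelation + the SLE₆ two-strand rotation law, and it certifies that
the statistic used on ℤ² measures κ′/4. [difficulty: L] -/
def HullWindingLawTri : Prop :=
  ∀ D : Literature.Probability.RandomPlanarGeometry.DobrushinDomain, (∀ᶠ δ in nhdsWithin (0:ℝ) (Set.Ioi 0), (Literature.Probability.Percolation.dobrushinData D δ).IsAdmissible) → ∀ r t : ℝ, 0 < r → Filter.Tendsto (fun δ : ℝ => (∫ ω, (fun pts : List ℂ => ∑ k ∈ Finset.range pts.length, if r ≤ Metric.infDist (pts.getD k 0) (frontier D.carrier) then Complex.exp (Complex.I * (t : ℂ) * ((Literature.Probability.LatticeModels.winding (pts.take (k + 1)) / Real.sqrt (Real.log δ⁻¹) : ℝ) : ℂ)) else 0) ((Literature.Probability.LatticeModels.explorationWalk (Literature.Probability.Percolation.dobrushinData D δ) ω).elim [] (fun γ => γ.2.2.support.map (fun f => (δ : ℂ) * Literature.Probability.LatticeModels.hexCenter f))) ∂(Literature.Probability.LatticeModels.triSitePercolation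 Literature.Probability.Percolation.half)) / (∫ ω, (fun pts : List ℂ => ∑ k ∈ Finset.range pts.length, if r ≤ Metric.infDist (pts.getD k 0) (frontier D.carrier) then (1 : ℂ) else 0) ((Literature.Probability.LatticeModels.explorationWalk (Literature.Probability.Percolation.dobrushinData D δ) ω).elim [] (fun γ => γ.2.2.support.map (fun f => (δ : ℂ) * Literature.Probability.LatticeModels.hexCenter f))) ∂(Literature.Probability.LatticeModels.triSitePercolation Literature.Probability.Percolation.half))) (nhdsWithin 0 (Set.Ioi 0)) (nhds (Complex.exp (-(3 / 4 * (t : ℂ) ^ 2))))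

-- item stmt-CriticalPhenomena-6902 · support · rank 3 · open · by planner — informal only, no Lean statement yet:
--   [crux] IGCouplingRigidity (card R3 + R4). Assume WindingFieldGFF. Along any δ_k → 0⁺ where (h_δ,
--   η_δ) converge jointly in law to (h, η), the pair satisfies the Miller–Sheffield imaginary-geometry
--   coupling axioms of a COUNTERFLOW line (definition request D2 `IsImaginaryGeometryCoupling 6 D`): for
--   every stopping time τ of η (first hitting of closed sets), conditionally on η[0,τ] the field h
--   restricted to Ω ∖ η[0,τ] is an independent Dirichlet GFF there plus the harmonic function with the
--   Dobrushin boundary data on ∂Ω and ∓λ′ + χ·winding on the two sides of η[0,τ] (λ′ = π/√6, χ = −1/√6)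
--   — obtaine

-- item stmt-CriticalPhenomena-6917 · support · rank 5 · open · by planner — informal only, no Lean statement yet:
--   [crux] BranchWindingNormalisation (card R1 restated: the DICTIONARY crux, cheapest and decisive).
--   With W_δ as in WindingFieldGFF (definition request D1): for fixed interior points z ≠ w of Ω, Var
--   W_δ(z) = 6·log(1/δ) + O(1) and Cov(W_δ(z), W_δ(w)) = 6·G_Ω(z, w) + O(1) as δ → 0⁺, G_Ω the Dirichlet
--   Green function normalised G(z,w) ~ log(1/|z−w|); the two-sided conditional offset ("winding gap")
--   E[W_δ(z_L) − W_δ(z_R) | η_δ] for targets mesoscopically left/right of the interface tends to 2λ′/|χ|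
--   = 2π, with W larger on the LEFT (open) side (sign fixing the counterflow orientation). Rationale:
--   the br

/-- item stmt-CriticalPhenomena-0697 · support · rank 9 · open · by planner
sources: CamiaNewman2007, LawlerSchrammWerner2001, Smirnov2001
Assembly: SLE6LimitZ2 → CardyFormulaZ2. For a conformal rectangle R=(Ω;a,b,c,d) run the exploration
interface of the Dobrushin domain (Ω; a, c) = R.chord 0 2: the discrete crossing (ab)_δ ↔ (cd)_δ
occurs iff the interface hits (cd)_δ before (bc)_δ (up to boundary effects); convergence in law +
a.s. continuity of the functional hitsBefore (R.arc 2) (R.arc 1) at SLE_6 samples (half-plane 3-arm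
estimates from RSW, Literature.Probability.Percolation.rsw_half) + Cardy's formula for SLE_6
(Literature fact Literature.Probability.RandomPlanarGeometry.sle_six_measureReal_hitsBefore, to be
taken as hypothesis) give R.HasCrossingLimit (bondDomainCrossingProb R) cardyFunction. Camia–Newman
2007 §§5–6 / Smirnov 2001 is the template on 𝕋. Caveat for provers: SLE6LimitZ2 carries the side
condition IsZdAdmissible eventually; conformal rectangles whose chord (0,2) fails it need a separate
approximation argument. -/
def SLE6ToCardy : Prop :=
  Literature.Probability.Percolation.SLE6LimitZ2 → CardyFormulaZ2

/-- item stmt-CriticalPhenomena-5709 · support · rank 9 · open · by planner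
sources: Kesten1987ScalingRelations, AizenmanBurchard1999, arXiv:math/9904022
[support] flow/counterflow disambiguation: every subsequential limit law of the ℤ² interface gives
mass 0 to the classes of SIMPLE curves (the limit touches itself), so in the IG dictionary the curve
is a counterflow line (κ′ = 6) and not a flow line (κ = 8/3, simple), the two roots of χ² = 1/6.
Expected provable from the ℤ² polychromatic 4-arm bound α₄ < 2 (pivotals at all scales; Literature
ArmExponentsFourArm / Kesten scaling relations) + RSW. [difficulty: L] -/
def NonSimpleLimitsZ2 : Prop :=
  ∀ D : Literature.Probability.RandomPlanarGeometry.DobrushinDomain, (∀ᶠ δ in nhdsWithin (0:ℝ) (Set.Ioi 0), (Literature.Probability.Percolation.dobrushinData D δ).IsZdAdmissible) → ∀ μ : MeasureTheory.Measure (Literature.Probability.RandomPlanarGeometry.CurveClass ℂ), MeasureTheory.IsProbabilityMeasure μ → Literature.Probability.RandomPlanarGeometry.IsSubseqLimitLaw (Ωδ := fun _ => Literature.Probability.Percolation.BondConfig (Literature.Probability.LatticeModels.Site 2)) (Literature.Probability.Percolation.bondInterface D) (fun _ => Literature.Probability.Percolation.bondPercolation (Literature.Probability.LatticeModels.zdGraph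 2) Literature.Probability.Percolation.half) μ → μ {c | ∃ γ : Literature.Probability.RandomPlanarGeometry.Curve ℂ, γ.IsSimple ∧ Literature.Probability.RandomPlanarGeometry.CurveClass.mk γ = c} = 0

/-- item stmt-CriticalPhenomena-5710 · support · rank 9 · open · by planner
sources: BillingsleyCPM1999, AizenmanBurchard1999, lean:Literature.Probability.RandomPlanarGeometry.convergesInLawToSLE_of_isTightLaws
[support] identification of subsequential limits + Aizenman–Burchard tightness (fact
`isTightLaws_map_bondInterface`) + a.e.-measurability (fact `aemeasurable_bondInterface`) +
uniqueness of the chordal SLE₆ law (fact `IsSLECurve.map_eq`) ⇒ SLE6LimitZ2; a three-line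
consequence of the PROVED criterion `convergesInLawToSLE_of_isTightLaws` (checked sorry-free in the
planner sketch, axioms standard). [difficulty: provable-now] -/
def LimitUpgrade : Prop :=
  IdentifiedLimitsSLE6 → Literature.Probability.Percolation.isTightLaws_map_bondInterface → Literature.Probability.Percolation.aemeasurable_bondInterface → Literature.Probability.RandomPlanarGeometry.IsSLECurve.map_eq → Literature.Probability.Percolation.SLE6LimitZ2

/-- item stmt-CriticalPhenomena-7676 · support · rank 9 · open · by planner
[support] a.e.-measurability of the ℤ² interface: for every Dobrushin domain D and mesh δ, the
re-oriented medial exploration interface (unfolded `bondInterface D δ`: CurveClass.mk of the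
endpoint-rule re-orientation of `medialExplorationCurve ⟨Ω, δ, (ab), (ba)⟩ ω`) is AEMeasurable under
P_{1/2} = bondPercolation (zdGraph 2) half — for bounded Ω and δ > 0 it has finite range with
cylinder-event fibres, otherwise it is constant. This is VERBATIM the Literature named fact
`Literature.Probability.Percolation.aemeasurable_bondInterface` with
`bondInterface`/`dobrushinData`/`orientCurve` unfolded (planner Check.lean: `Iff.rfl`), the ONE
genuinely load-bearing undischarged cone fact of this route (needs-fact: it is a hypothesis of the
Assembly); template for the proof: `aemeasurable_triInterface_holds`
(InterfaceScalingLimitMeasurability.lean). Whoever discharges the fact closes this item by `exact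
aemeasurable_bondInterface_holds`, and conversely. [difficulty: S] [provable-now] [sources:
AizenmanBurchard1999 §2.1, Smirnov2001 §2,
lean:Literature.Probability.Percolation.aemeasurable_bondInterface] -/
def BondInterfaceAEMeasurable : Prop :=
  ∀ (D : Literature.Probability.RandomPlanarGeometry.DobrushinDomain) (δ : ℝ), AEMeasurable (fun ω : Literature.Probability.Percolation.BondConfig (Literature.Probability.LatticeModels.Site 2) => (fun c : C(unitInterval, ℂ) => Literature.Probability.RandomPlanarGeometry.CurveClass.mk (if dist (c 0) (D.pt 0) ≤ dist (c 0) (D.pt 1) then (⟨c⟩ : Literature.Probability.RandomPlanarGeometry.Curve ℂ) else ⟨c.comp ⟨unitInterval.symm, unitInterval.continuous_symm⟩⟩)) (Literature.Probability.LatticeModels.medialExplorationCurve ⟨D.carrier, δ, D.arc 0, D.arc 1⟩ ω)) (Literature.Probability.Percolation.bondPercolation (Literature.Probability.LatticeModels.zdGraph 2) Literature.Probability.Percolation.half)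

/-- item stmt-CriticalPhenomena-5711 · assembly · rank 1 · open · by planner
sources: Smirnov2001, CamiaNewman2007, arXiv:1201.1496
[assembly] IdentifiedLimitsSLE6 → LimitUpgrade → SLE6ToCardy → isTightLaws_map_bondInterface →
aemeasurable_bondInterface → IsSLECurve.map_eq → CardyFormulaZ2. -/
def Assembly : Prop :=
  IdentifiedLimitsSLE6 → LimitUpgrade → SLE6ToCardy → Literature.Probability.Percolation.isTightLaws_map_bondInterface → Literature.Probability.Percolation.aemeasurable_bondInterface → Literature.Probability.RandomPlanarGeometry.IsSLECurve.map_eq → CardyFormulaZ2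

end Summit.CriticalPhenomena.CardyFormulaZ2.Theses.CardyWindingIG
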